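import Mathlib
import Summits.Ventures.HodgeRepro2.T5SmoothIsotypic
import Summits.Ventures.HodgeRepro2.T6N5LocalDatum
import Summits.Ventures.HodgeRepro2.T6N5LocalHyp
import Summits.Ventures.HodgeRepro2.T6N5LocalHypSmooth
import Summits.Ventures.HodgeRepro2.T6N5Local
import Summits.Ventures.HodgeRepro2.T6N5LocalWeil
import Summits.Ventures.HodgeRepro2.T6N5LocalCharDatum
import Summits.Ventures.HodgeRepro2.T6N5LocalInertHyp
import Summits.Ventures.HodgeRepro2.T6N5LocalInert
import Summits.Ventures.HodgeRepro2.T6N5LocalInertWeil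
import Summits.Ventures.HodgeRepro2.T6N5LocalRamHyp
import Summits.Ventures.HodgeRepro2.T6N5LocalRam
import Summits.Ventures.HodgeRepro2.T6N5LocalRamWeil

/-!
# T6N5LocalSmooth — Tier 6, M2 sub-step N5 (t6-p8's half): Theorem N5.T2 from the Epsilon Dichotomy restricted to
the print's characters, with the carried Weil representation smooth for the OPEN subgroups of `U(V)`

The chain of `T6N5Local` → `T6N5LocalWeil` → `T6N5LocalInertWeil` / `T6N5LocalRamWeil` consumes the display
`BFGYYZ2025_Thm3_5` over every homomorphism `E_v^× →* ℂˣ`; `T6N5LocalWeilQuotientKer` records why that is too strong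
on the concrete carriers. This file re-runs the chain on the display restricted to the print's characters
(`T6N5LocalHypSmooth.BFGYYZ2025_Thm3_5_smooth D Sm`): the only use of the dichotomy in the chain is the «only if»
direction at the character `α` produced by (A1), so (A1) is now asked to produce a SMOOTH `α_K` —
`N5Local_main_smooth` — and that is what a carried Weil representation gives when it is smooth for the open
subgroups of `U(V) = E¹_v`: with `j : E_v^× →* U(V)` the map `x ↦ x/x̄` (`ofOne α = α ∘ j`) and the open smoothness
`∀ v, ∃ n, v fixed by j(U_E^n)` (`IsSmoothOpen`), a non-zero `α`-isotypic vector forces `α ∘ j` trivial on `U_E^n`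
(`isSmooth_ofOne_of_thetaOf`). `hA1_smooth` is (A1) with a smooth character; `N5Local_main_inert_weil_smooth` /
`N5Local_main_ram_weil_smooth` are Theorem N5.T2 at inert / ramified places on the restricted display, the finite-index
smoothness `hsm` (the isotypic decomposition, p4's `T5SmoothIsotypic`) and the open smoothness `hsmU` — both
properties of a smooth representation of the compact group `U(V)`.
README §8(d): uses an L-value-free non-vanishing device: NO.
-/

namespace Summit.Ventures.HodgeRepro2.T6.N5LocalSmooth

open Summit.Ventures.HodgeRepro2.T6.N5LocalDatum Summit.Ventures.HodgeRepro2.T6.N5Local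
  Summit.Ventures.HodgeRepro2.T6.N5LocalWeil Summit.Ventures.HodgeRepro2.T6.N5LocalCharDatum
  Summit.Ventures.HodgeRepro2.T6.N5LocalInertWeil Summit.Ventures.HodgeRepro2.T6.N5LocalRamWeil
  Summit.Ventures.HodgeRepro2.T6.N5LocalInert Summit.Ventures.HodgeRepro2.T6.N5LocalRam
  Summit.Ventures.HodgeRepro2.T6.Hyp Summit.Ventures.HodgeRepro2.T5SmoothIsotypic

/-! ### The abstract theorem on the restricted display -/

section Abstract

variable (D : LocalSignDatum) (Sm : D.Char → Prop)

/-- LEMMA N5.L3 («both signs occur») from the restricted display and (A1) with a smooth character. -/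
theorem signClass_nonempty_smooth (h35 : BFGYYZ2025_Thm3_5_smooth D Sm)
    (hA1 : ∀ s : ℤˣ, ∃ α : D.Char, D.IsCO α ∧ Sm α ∧ D.Theta s α)
    (hW : D.epsdW = 1) (hη : D.η * D.η = 1) (hχW : D.IsCS D.χW) (s : ℤˣ) :
    ∃ ξ : D.Char, ξ ∈ D.signClass s := by
  obtain ⟨α, hα, hαs, hθ⟩ := hA1 s
  refine ⟨D.χW⁻¹ * α, isCS_inv_χW_mul D hη hχW hα, ?_⟩
  have := (h35 s α hα hαs).mp hθ
  rwa [hW, mul_one] at this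

/-- THEOREM N5.T2 on the restricted display: `N5Local_main` with `h35` restricted to the characters `Sm` and (A1)
producing such a character. -/
theorem N5Local_main_smooth (h35 : BFGYYZ2025_Thm3_5_smooth D Sm)
    (hA1 : ∀ s : ℤˣ, ∃ α : D.Char, D.IsCO α ∧ Sm α ∧ D.Theta s α)
    (hW : D.epsdW = 1) (hη : D.η * D.η = 1) (hχW : D.IsCS D.χW)
    (hiii : D.ηu = -1 → D.ηLine 0 = D.ηLine 1 → ∃ a c : D.Char, D.IsCS a ∧ D.IsCS c ∧
      D.eps a = D.ηLine 0 ∧ D.eps c = -D.ηLine 0 ∧ D.eps (c⁻¹ * a * a) = -D.ηLine 0) :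
    ∃ ξ : Fin 4 → D.Char, LocalSolution D ξ := by
  obtain ⟨ξa, hξa⟩ := signClass_nonempty_smooth D Sm h35 hA1 hW hη hχW (D.ηLine 0)
  obtain ⟨ξb, hξb⟩ := signClass_nonempty_smooth D Sm h35 hA1 hW hη hχW (D.ηLine 1)
  rcases Int.units_eq_one_or D.ηu with hu | hu
  · -- case (i): v ∉ S_g
    refine ⟨![ξa, ξb, ξa, ξb], ?_, hξa.2, hξb.2, ?_, ?_, ?_⟩
    · intro i
      fin_cases i <;> simp [hξa.1, hξb.1]
    · simp [hu, hξa.2]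
    · simp [hu, hξb.2]
    · simp
  · -- v ∈ S_g
    rcases Int.units_eq_one_or (D.ηLine 0 * D.ηLine 1) with h01 | h01
    · -- case (iii): s_a = s_b
      have h01' : D.ηLine 0 = D.ηLine 1 := by
        calc D.ηLine 0 = D.ηLine 0 * (D.ηLine 1 * D.ηLine 1) := by rw [Int.units_mul_self, mul_one]
          _ = (D.ηLine 0 * D.ηLine 1) * D.ηLine 1 := by rw [mul_assoc]
          _ = D.ηLine 1 := by rw [h01, one_mul]
      obtain ⟨a, c, ha, hc, has, hcs, hc'⟩ := hiii hu h01'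
      exact localSolution_of_pair D hu h01' ha hc has hcs hc'
    · -- case (ii): s_a = −s_b — the swap
      have hba : D.ηLine 1 = D.ηu * D.ηLine 0 := by
        rw [hu]
        calc D.ηLine 1 = (D.ηLine 0 * D.ηLine 0) * D.ηLine 1 := by rw [Int.units_mul_self, one_mul]
          _ = D.ηLine 0 * (D.ηLine 0 * D.ηLine 1) := by rw [mul_assoc]
          _ = D.ηLine 0 * (-1) := by rw [h01]
          _ = -1 * D.ηLine 0 := mul_comm _ _
      have hab : D.ηLine 0 = D.ηu * D.ηLine 1 := by
        rw [hba, ← mul_assoc, Int.units_mul_self, one_mul]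
      refine ⟨![ξa, ξb, ξb, ξa], ?_, hξa.2, hξb.2, ?_, ?_, ?_⟩
      · intro i
        fin_cases i <;> simp [hξa.1, hξb.1]
      · simp [hξb.2, hba]
      · simp [hξa.2, hab]
      · simp [mul_comm]

end Abstract

/-! ### Open smoothness of a carried Weil representation makes the isotypic characters smooth -/

section Open

variable {A E : Type} [AddCommGroup A] [CommGroup E] {V : Type} [AddCommGroup V] [Module ℂ V]

/-- A non-zero `α`-isotypic vector fixed by `j(S)` makes `α ∘ j` trivial on `S`. -/
theorem addChar_comp_eq_one_of_isotypic (ρ : Representation ℂ (Multiplicative A) V) (α : AddChar A ℂ)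
    (j : E →* Multiplicative A) {x : V} (hx : x ∈ isotypic ρ α) (hx0 : x ≠ 0) (S : Subgroup E)
    (hS : ∀ u ∈ S, ρ (j u) x = x) : ∀ u ∈ S, α (Multiplicative.toAdd (j u)) = 1 := by
  intro u hu
  have h1 : ρ (Multiplicative.ofAdd (Multiplicative.toAdd (j u))) x = α (Multiplicative.toAdd (j u)) • x :=
    hx (Multiplicative.toAdd (j u))
  rw [ofAdd_toAdd, hS u hu] at h1
  have h3 : (α (Multiplicative.toAdd (j u)) - 1) • x = 0 := by
    rw [sub_smul, one_smul, ← h1, sub_self]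
  rcases smul_eq_zero.mp h3 with h | h
  · exact sub_eq_zero.mp h
  · exact absurd h hx0

end Open

/-! ### Inert places -/

section Inert

variable (X : InertWeilDatum) (j : X.D.E →* Multiplicative X.A)
  (hj : ∀ (α : AddChar X.A ℂ) (x : X.D.E), ((X.ofOne α x : ℂˣ) : ℂ) = α (Multiplicative.toAdd (j x)))

/-- Open smoothness of the carried Weil representation of `V_s`: every vector is fixed by the image of some
principal-unit subgroup `U_E^n` of `E_v^×` (an open subgroup of `U(V) = E¹_v`). -/
def InertIsSmoothOpen (s : ℤˣ) : Prop :=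
  ∀ v : X.Wsp s, ∃ n : ℕ, ∀ u ∈ X.D.U n, X.ωWeil s (j u) v = v

include hj in
/-- A character with a non-zero theta-lift (the defined predicate) in an open-smooth Weil representation is smooth. -/
theorem isSmooth_ofOne_of_thetaOf_inert (s : ℤˣ) (hsmU : InertIsSmoothOpen X j s) (ξ : X.D.E →* ℂˣ)
    (hθ : X.toWeil.thetaOf s ξ) : X.D.IsSmooth ξ := by
  obtain ⟨α, hα, hne⟩ := hθ
  obtain ⟨x, hx, hx0⟩ := (Submodule.ne_bot_iff _).mp hne
  obtain ⟨n, hn⟩ := hsmU x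
  refine ⟨n, fun u hu => ?_⟩
  rw [MonoidHom.mem_ker]
  have h1 := addChar_comp_eq_one_of_isotypic (X.ωWeil s) α j hx hx0 (X.D.U n) hn u hu
  have hξ : ξ = X.ofOne α := hα.symm
  subst hξ
  apply Units.ext
  rw [hj, Units.val_one]
  exact h1

include hj in
/-- (A1) with a smooth character, from non-vanishing, finite-index smoothness (the isotypic decomposition) and open
smoothness. -/
theorem hA1_smooth_inert (hsm : ∀ s, X.toWeil.IsSmoothCompact s) (hsmU : ∀ s, InertIsSmoothOpen X j s)
    [∀ s, Nontrivial (X.Wsp s)] (hofOne : ∀ α, X.toWeil.toLocalSignDatum.IsCO (X.toWeil.ofOne α)) :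
    ∀ s : ℤˣ, ∃ ξ : X.toWeil.toLocalSignDatum.Char,
      X.toWeil.toLocalSignDatum.IsCO ξ ∧ X.D.IsSmooth ξ ∧ X.toWeil.toLocalSignDatum.Theta s ξ := by
  intro s
  obtain ⟨α, hα⟩ := X.toWeil.exists_isotypic_ne_bot s (hsm s)
  have hθ : X.toWeil.thetaOf s (X.ofOne α) := ⟨α, rfl, hα⟩
  exact ⟨X.ofOne α, hofOne α, isSmooth_ofOne_of_thetaOf_inert X j hj s (hsmU s) _ hθ, hθ⟩

include hj in
/-- THEOREM N5.T2 AT AN INERT PLACE on the restricted display: `N5Local_main_inert_weil` with `h35` restricted to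
the smooth characters and the open smoothness `hsmU` added. -/
theorem N5Local_main_inert_weil_smooth (hG : GGP2012ex_Prop3_1 X.D)
    (hT : Tate1979_3_2_2_3 X.D.epsT (fun ξ a => ((ξ a : ℂˣ) : ℂ)) X.D.tw X.D.sc X.D.nrm (fun _ => True))
    (hc : X.D.toCharDatum.Conventions) (hU : Antitone X.D.U) (hψδ : X.D.ψδ = X.D.tw X.D.ψ0 X.D.t)
    (ht : X.D.t ∈ X.D.Fsub)
    (hηt : ((X.D.η ⟨X.D.t, ht⟩ : ℂˣ) : ℂ) = (-1 : ℂ) ^ (X.D.d + 1))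
    (hin : X.D.IsInert) (hψ0 : X.D.IsNormalised X.D.ψ0)
    (hμ : ∃ μ : X.D.E →* ℂˣ, X.D.toLocalSignDatum.IsCS μ ∧ X.D.IsUnramified μ)
    (hβ : ∀ n : ℕ, 1 ≤ n → ∃ β : X.D.E →* ℂˣ, X.D.toLocalSignDatum.IsCO β ∧ X.D.IsSmooth β ∧ X.D.cond β = n)
    (h35 : BFGYYZ2025_Thm3_5_smooth X.toWeil.toLocalSignDatum X.D.IsSmooth)
    (hsm : ∀ s, X.toWeil.IsSmoothCompact s) (hsmU : ∀ s, InertIsSmoothOpen X j s)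
    [∀ s, Nontrivial (X.Wsp s)]
    (hofOne : ∀ α, X.toWeil.toLocalSignDatum.IsCO (X.toWeil.ofOne α))
    (hW : X.toWeil.toLocalSignDatum.epsdW = 1)
    (hη : X.toWeil.toLocalSignDatum.η * X.toWeil.toLocalSignDatum.η = 1)
    (hχW : X.toWeil.toLocalSignDatum.IsCS X.toWeil.toLocalSignDatum.χW) :
    ∃ ξ : Fin 4 → X.toWeil.toLocalSignDatum.Char, LocalSolution X.toWeil.toLocalSignDatum ξ :=
  N5Local_main_smooth X.toWeil.toLocalSignDatum X.D.IsSmooth h35 (hA1_smooth_inert X j hj hsm hsmU hofOne)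
    hW hη hχW (fun _ _ => hiii_of_inert X.D hG hT hc hU hψδ ht hηt hin hψ0 hμ hβ)

end Inert

/-! ### Ramified places -/

section Ram

variable (X : RamWeilDatum) (j : X.D.E →* Multiplicative X.A)
  (hj : ∀ (α : AddChar X.A ℂ) (x : X.D.E), ((X.ofOne α x : ℂˣ) : ℂ) = α (Multiplicative.toAdd (j x)))

/-- Open smoothness of the carried Weil representation of `V_s` at a ramified place. -/
def RamIsSmoothOpen (s : ℤˣ) : Prop :=
  ∀ v : X.Wsp s, ∃ n : ℕ, ∀ u ∈ X.D.U n, X.ωWeil s (j u) v = v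

include hj in
/-- A character with a non-zero theta-lift in an open-smooth Weil representation is smooth (ramified place). -/
theorem isSmooth_ofOne_of_thetaOf_ram (s : ℤˣ) (hsmU : RamIsSmoothOpen X j s) (ξ : X.D.E →* ℂˣ)
    (hθ : X.toWeil.thetaOf s ξ) : X.D.IsSmooth ξ := by
  obtain ⟨α, hα, hne⟩ := hθ
  obtain ⟨x, hx, hx0⟩ := (Submodule.ne_bot_iff _).mp hne
  obtain ⟨n, hn⟩ := hsmU x
  refine ⟨n, fun u hu => ?_⟩
  rw [MonoidHom.mem_ker]
  have h1 := addChar_comp_eq_one_of_isotypic (X.ωWeil s) α j hx hx0 (X.D.U n) hn u hu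
  have hξ : ξ = X.ofOne α := hα.symm
  subst hξ
  apply Units.ext
  rw [hj, Units.val_one]
  exact h1

include hj in
/-- (A1) with a smooth character at a ramified place. -/
theorem hA1_smooth_ram (hsm : ∀ s, X.toWeil.IsSmoothCompact s) (hsmU : ∀ s, RamIsSmoothOpen X j s)
    [∀ s, Nontrivial (X.Wsp s)] (hofOne : ∀ α, X.toWeil.toLocalSignDatum.IsCO (X.toWeil.ofOne α)) :
    ∀ s : ℤˣ, ∃ ξ : X.toWeil.toLocalSignDatum.Char,
      X.toWeil.toLocalSignDatum.IsCO ξ ∧ X.D.IsSmooth ξ ∧ X.toWeil.toLocalSignDatum.Theta s ξ := by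
  intro s
  obtain ⟨α, hα⟩ := X.toWeil.exists_isotypic_ne_bot s (hsm s)
  have hθ : X.toWeil.thetaOf s (X.ofOne α) := ⟨α, rfl, hα⟩
  exact ⟨X.ofOne α, hofOne α, isSmooth_ofOne_of_thetaOf_ram X j hj s (hsmU s) _ hθ, hθ⟩

include hj in
/-- THEOREM N5.T2 AT A RAMIFIED PLACE on the restricted display: `N5Local_main_ram_weil` with `h35` restricted to the
smooth characters and the open smoothness `hsmU` added. -/
theorem N5Local_main_ram_weil_smooth (hT6 : Tate1979_3_2_6_3 X.D) (hG : GGP2012_Prop5_1_2 X.D)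
    (hU : Antitone X.D.U) (hω : X.D.IsUnramified (X.D.omega (1 / 2))) (hconj : X.D.IsConjInv X.D.ψδ)
    (hμ : ∃ μ : X.D.E →* ℂˣ, X.D.toLocalSignDatum.IsCO μ ∧ X.D.IsUnramified μ ∧ ((μ X.D.π : ℂˣ) : ℂ) = -1 ∧
      μ * μ = 1)
    (hodd : ∃ ωt : X.D.E →* ℂˣ, X.D.toLocalSignDatum.IsCS ωt ∧ X.D.IsSmooth ωt ∧ Odd (X.D.cond ωt))
    (heven : ∀ k : ℕ, ∃ β : X.D.E →* ℂˣ, X.D.toLocalSignDatum.IsCO β ∧ X.D.IsSmooth β ∧ Even (X.D.cond β) ∧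
      k < X.D.cond β)
    (h35 : BFGYYZ2025_Thm3_5_smooth X.toWeil.toLocalSignDatum X.D.IsSmooth)
    (hsm : ∀ s, X.toWeil.IsSmoothCompact s) (hsmU : ∀ s, RamIsSmoothOpen X j s)
    [∀ s, Nontrivial (X.Wsp s)]
    (hofOne : ∀ α, X.toWeil.toLocalSignDatum.IsCO (X.toWeil.ofOne α))
    (hW : X.toWeil.toLocalSignDatum.epsdW = 1)
    (hη : X.toWeil.toLocalSignDatum.η * X.toWeil.toLocalSignDatum.η = 1)
    (hχW : X.toWeil.toLocalSignDatum.IsCS X.toWeil.toLocalSignDatum.χW) :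
    ∃ ξ : Fin 4 → X.toWeil.toLocalSignDatum.Char, LocalSolution X.toWeil.toLocalSignDatum ξ :=
  N5Local_main_smooth X.toWeil.toLocalSignDatum X.D.IsSmooth h35 (hA1_smooth_ram X j hj hsm hsmU hofOne)
    hW hη hχW (fun _ _ => hiii_of_ramified X.D hT6 hG hU hω hconj hμ hodd heven)

end Ram

end Summit.Ventures.HodgeRepro2.T6.N5LocalSmooth
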